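import Literature.NumberTheory.LFunctions.DensityHypothesisStatus
import Literature.NumberTheory.LFunctions.ZetaZerosProofs
import HarnessLib

/-!
# Bourgain's density theorem: the density hypothesis for `σ ≥ 25/32` (BOUNDARY named fact, frozen), and the glue to `ZeroDensityEstimate (fun _ ↦ 2) (25/32)`

LABEL (line 1): **NOT RH-BEARING** — a zero-density theorem COUNTS zeros of `ζ` off the critical
line for `σ ≥ 25/32`; it never empties the strip
(`Literature.Barriers.RiemannHypothesis.LindelofBacklund`). RH-FREE literature (Bourgain 2000;
Tao–Trudgian–Yang 2025), typed as a BOUNDARY named fact of the rh-crit C4 corpus — its discharge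
(Bourgain's 1995/2000 large-values method, twelfth-moment input) is a separate corpus, frozen, not
scheduled (gm-lead RULING A7, 2026-08-26). Nothing in this file bears on the truth of RH.

Topic `NumberTheory/LFunctions`, family RH; bears on the LADDER-RH §4 HELD row `DensityLadder`
(`Summits/RiemannHypothesis/RiemannHypothesis/Theses/DensityLadder.lean` :126–129: "Wanted
Literature named fact (S2, for a literature prover): `zeroDensity_bourgain :
ZeroDensityEstimate (fun _ ↦ 2) (25 / 32)` [Bourgain2000 main theorem for σ > 25/32;
TaoTrudgianYang2025 Thm 51 at the endpoint]"; stub FLOOR of the crux line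
`Cruxes/DensityBelowBourgain/Lines/birth.lean`).

Sources. ORIGIN: J. Bourgain, *On large values estimates for Dirichlet polynomials and the density
hypothesis for the Riemann zeta function*, Internat. Math. Res. Notices 2000, no. 3, 133–146 —
the density hypothesis `N(σ, T) ≪ T^{2(1−σ)+ε}` for all `σ > 25/32` (NOT HELD by the literature
store at the time of typing; acquisition request acq-01084; reported verbatim by Tao–Trudgian–Yang:
"we recall a well-known result of Bourgain [bourgain_large_2000] that the density hypothesis
`A(σ) ≤ 2` holds for all `σ > 25/32`"). TYPED FROM (held, read first-hand, arXiv:2501.16779 §6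
p. 19): T. Tao, T. Trudgian, A. Yang, **Theorem 51 (Improved Bourgain density hypothesis bound)**:
"For fixed `17/22 ≤ σ ≤ 4/5`, one has `A(σ) ≤ max(2/(9σ−6), 9/(8(2σ−1)))`. Thus one has
`A(σ) ≤ 2/(9σ−6)` for `17/22 ≤ σ ≤ 38/49` and `A(σ) ≤ 9/(8(2σ−1))` for `38/49 ≤ σ ≤ 4/5`." with
their Definition 37 (p. 16): "`N(σ, T)` denote[s] the number of zeroes `ρ` … with `Re(ρ) ≥ σ` and
`|Im(ρ)| ≤ T` … `A(σ)` is the infimum of all `A` such that for every `ε > 0` there exists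
`C, δ > 0` such that `N(σ−δ, T) ≤ C T^{A(1−σ)+ε}` whenever `T ≥ C`." At `σ = 25/32`:
`9/(8(2σ−1)) = 2` and `2/(9σ−6) = 64/33 < 2`, so Theorem 51 contains the endpoint of Bourgain's
range; both bounds decrease in `σ`.

## What this file declares

* NAMED FACT (boundary, frozen) `TaoTrudgianYang2025_theorem_51` — Theorem 51 AS PRINTED, in the
  non-asymptotic words of Definition 37 (`∀ ε ∃ C, δ > 0 ∀ T ≥ C, N(σ−δ, T) ≤ C T^{A(1−σ)+ε}`
  with `A = max(2/(9σ−6), 9/(8(2σ−1)))`, `17/22 ≤ σ ≤ 4/5`), for the tree's count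
  `N(σ, T) = zetaZeroCountRe σ T` (zeros with `0 < Im ρ ≤ T`, at most TTY's two-sided count, so the
  typed statement is implied by the printed one).
* PROVED `zeroDensity_bourgain_of_theorem_51 (h : TaoTrudgianYang2025_theorem_51) :
  ZeroDensityEstimate (fun _ ↦ 2) (25/32)` — the route's requested shape: on `[25/32, 4/5]` from
  the fact (`max(…) ≤ 2 ⟺ σ ≥ 25/32`, and `N(σ, T) ≤ N(σ−δ, T)`,
  `zetaZeroCountRe_anti_left_holds`); on `[11/14, 1] ⊃ (4/5, 1]` it is the tree THEOREM
  `zeroDensity_jutila` (Jutila 1977, `DensityHypothesisStatus.lean`). No second `Prop` is introduced.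

## References

* J. Bourgain, IMRN 2000, no. 3, 133–146 (origin; doi:10.1155/s107379280000009x). [`Bourgain2000`]
* T. Tao, T. Trudgian, A. Yang, arXiv:2501.16779 (2025), §6: Definition 37 (p. 16), Theorem 51 and
  the remark preceding it (p. 19). [`TaoTrudgianYang2025`]
* M. Jutila, Acta Arith. 32 (1977) 55–62, Corollary (1.8) (the range `σ ≥ 11/14`, tree theorem
  `zeroDensity_jutila`). [`Jutila1977`]
-/

noncomputable section

open Filter Asymptotics

namespace Literature.NumberTheory.LFunctions

/-! ## The named fact (BOUNDARY, frozen): Tao–Trudgian–Yang 2025, Theorem 51 -/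

/-- NAMED FACT (BOUNDARY, frozen; origin Bourgain 2000) — **Tao–Trudgian–Yang 2025, Theorem 51
(Improved Bourgain density hypothesis bound)**: "For fixed `17/22 ≤ σ ≤ 4/5`, one has
`A(σ) ≤ max(2/(9σ−6), 9/(8(2σ−1)))`." Here `A(σ) ≤ A` is rendered by their Definition 37 in its
printed non-asymptotic form — "for every `ε > 0` there exists `C, δ > 0` such that
`N(σ−δ, T) ≤ C T^{A(1−σ)+ε}` whenever `T ≥ C`" — for the tree's zero count
`N(σ, T) = zetaZeroCountRe σ T` (`Re ρ ≥ σ`, `0 < Im ρ ≤ T`; TTY count `|Im ρ| ≤ T`, which is at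
least the tree's, so this is implied by the printed statement). It sharpens and contains (at
`σ = 25/32`, where `9/(8(2σ−1)) = 2`) Bourgain's theorem "the density hypothesis `A(σ) ≤ 2` holds
for all `σ > 25/32`" (IMRN 2000, no. 3, 133–146; not held — typed from TTY, acq-01084). BOUNDARY
fact of the rh-crit C4 corpus: its proof (Bourgain's large values method with the twelfth moment,
TTY Corollary 43 with `τ₀ = min(9(3σ−2)/2, 8(2σ−1)/3)`) is a separate corpus, not scheduled.
Users take `(h : TaoTrudgianYang2025_theorem_51)`.
[cite: TaoTrudgianYang2025, Theorem 51, p. 19; Definition 37, p. 16] [cite: Bourgain2000, main theorem (density hypothesis for σ > 25/32)] -/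
def TaoTrudgianYang2025_theorem_51 : Prop :=
  ∀ σ : ℝ, 17 / 22 ≤ σ → σ ≤ 4 / 5 → ∀ ε : ℝ, 0 < ε → ∃ C δ : ℝ, 0 < δ ∧ ∀ T : ℝ, C ≤ T →
    (zetaZeroCountRe (σ - δ) T : ℝ) ≤
      C * T ^ (max (2 / (9 * σ - 6)) (9 / (8 * (2 * σ - 1))) * (1 - σ) + ε)

/-! ## The glue to the route's shape: the density hypothesis on `[25/32, 1]` -/

/-- For `σ ≥ 25/32` the exponent of Theorem 51 is at most `2`:
`max(2/(9σ−6), 9/(8(2σ−1))) ≤ 2 ⟺ σ ≥ 25/32` (the second entry; the first is `≤ 2` already for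
`σ ≥ 7/9`). [cite: TaoTrudgianYang2025, Theorem 51 and the remark preceding it] -/
theorem ttyExponent51_le_two {σ : ℝ} (h₀ : 25 / 32 ≤ σ) :
    max (2 / (9 * σ - 6)) (9 / (8 * (2 * σ - 1))) ≤ 2 := by
  have h9 : 0 < 9 * σ - 6 := by linarith
  have h2 : 0 < 8 * (2 * σ - 1) := by linarith
  refine max_le ?_ ?_
  · rw [div_le_iff₀ h9]; linarith
  · rw [div_le_iff₀ h2]; linarith

/-- **Bourgain's density theorem in the route's shape, from the boundary fact**: the density
hypothesis `N(σ, T) ≪_ε T^{2(1−σ)+ε}` holds uniformly for `25/32 ≤ σ ≤ 1`, i.e.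
`ZeroDensityEstimate (fun _ ↦ 2) (25/32)` — on `[25/32, 4/5]` from Tao–Trudgian–Yang's Theorem 51
(`A(σ) ≤ max(2/(9σ−6), 9/(8(2σ−1))) ≤ 2` there, `ttyExponent51_le_two`, and
`N(σ, T) ≤ N(σ−δ, T)`), on `(4/5, 1] ⊂ [11/14, 1]` from Jutila's theorem, a tree THEOREM
(`zeroDensity_jutila`). This is the name `zeroDensity_bourgain` reserved by
`Theses/DensityLadder.lean`, delivered as a proved conditional (one boundary fact, no second
`Prop`). [cite: Bourgain2000, main theorem] [cite: TaoTrudgianYang2025, Theorem 51] -/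
theorem zeroDensity_bourgain_of_theorem_51 (h : TaoTrudgianYang2025_theorem_51) :
    ZeroDensityEstimate (fun _ ↦ 2) (25 / 32) := by
  intro ε hε σ h₀ h₁
  rcases le_or_gt σ (4 / 5) with h45 | h45
  · -- `25/32 ≤ σ ≤ 4/5`: Theorem 51
    obtain ⟨C, δ, hδ, hC⟩ := h σ (by linarith) h45 ε hε
    have hm := ttyExponent51_le_two h₀
    refine IsBigO.of_bound C ?_
    filter_upwards [eventually_ge_atTop C, eventually_ge_atTop (1 : ℝ)] with T hTC hT1
    have hT0 : 0 < T := by linarith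
    have hanti : (zetaZeroCountRe σ T : ℝ) ≤ zetaZeroCountRe (σ - δ) T := by
      exact_mod_cast zetaZeroCountRe_anti_left_holds T (by linarith : σ - δ ≤ σ)
    have hmain := hanti.trans (hC T hTC)
    -- `C ≥ 0` (the bound is a bound of a nonnegative quantity by `C · (positive)`)
    have hpos : 0 < T ^ (max (2 / (9 * σ - 6)) (9 / (8 * (2 * σ - 1))) * (1 - σ) + ε) :=
      Real.rpow_pos_of_pos hT0 _
    have hC0 : 0 ≤ C := by
      have h0 : (0 : ℝ) ≤ zetaZeroCountRe σ T := Nat.cast_nonneg _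
      nlinarith
    have hexp : T ^ (max (2 / (9 * σ - 6)) (9 / (8 * (2 * σ - 1))) * (1 - σ) + ε) ≤
        T ^ ((fun _ : ℝ ↦ (2 : ℝ)) σ * (1 - σ) + ε) := by
      refine Real.rpow_le_rpow_of_exponent_le hT1 ?_
      have h1σ : 0 ≤ 1 - σ := by linarith
      have := mul_le_mul_of_nonneg_right hm h1σ
      simp only []
      linarith
    rw [Real.norm_of_nonneg (Nat.cast_nonneg _),
      Real.norm_of_nonneg (Real.rpow_nonneg hT0.le _)]
    exact hmain.trans (mul_le_mul_of_nonneg_left hexp hC0)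
  · -- `4/5 < σ ≤ 1`: Jutila's theorem (tree theorem, `σ ≥ 11/14`)
    exact zeroDensity_jutila ε hε σ (by linarith) h₁

end Literature.NumberTheory.LFunctions

end
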